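import Literature.MathematicalPhysics.QuantumFieldTheory.Balaban1983to89.B9Thm31NearFlatCoerciveClassZdPer
import Literature.MathematicalPhysics.QuantumFieldTheory.Balaban1983to89.B9Thm311InverseL2BoundsZd

/-!
# `Balaban1983to89.B9Thm311InverseL2BoundsZdPer` — [Balaban1985BackgroundPropagators] Thm 3.1 p. 397 ((3.42) at `n = 0`) ∕ Thm 3.11 p. 416 ON THE TORUS `T_P` READ ON `ℤᵈ`:
# the `L²_τ` bounds of the INVERSES `G′(U₀) = (Δ′_a(U₀))⁻¹` and `(Q′G′²Q′*)⁻¹` from a coercivity constant («bounded from below by a positive constant, hence the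
# inverse is bounded», [Balaban1984PropagatorsII] p. 226), and — with `B9Thm31NearFlatCoerciveClassZdPer` — ONE bound `⟨G′(U₀)f, G′(U₀)f⟩_{T_P} ≤ γ⁻²⟨f, f⟩_{T_P}` for
# EVERY background of the explicit small-field class of the torus; the periodic twin of this lineage's g4 `B9Thm311InverseL2BoundsZd`

statement-level skeleton of published theorems with citation tags; proofs where landed; nothing here is a claim about the
Yang–Mills mass gap

`[Balaban1985BackgroundPropagators]` ("B9", CMP **99** (1985) 389–434) Thm 3.1 p. 397: *«|(D^η_U)ⁿ G′(U) f| ≤ …»* — at `n = 0` the `L²` boundedness of `G′`; Thm 3.11 p. 416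
*«the operators Δ′_a, G′, Q′G′²Q′*, (Q′G′²Q′*)⁻¹ … are positive definite … uniformly in U»*; (3.24)–(3.25) p. 394.  `[Balaban1984PropagatorsII]` ("[4]", CMP **96** (1984)
223–250) p. 226, (2.22): the lower bound of the quadratic form gives the bound of the inverse.  `[Balaban1985RegularSpaces]` p. 77 *«Ω_j = T_η»*, (1.131) p. 99.
PDF held: `paper:balaban1985-cmp99-background-propagators` pp. 394, 397, 416 (re-read by this seat, 2026-08-28).

CITATION HEADER (lean-in-tree rule).  Cell `pub-ymgap` (YM Track A, HUMAN RULING D-0062 ∕ D-0149 width push), DAG node N06 = [B9], width seat `pub-ymgap-dag-n06-w4`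
(g6), the (β′-PERIODIC) road.  WHY: after `regularPrimePer_of_class` (the scalar regime at every class background of the torus) the next printed clause is the BOUND of
the inverse, uniformly on the class — the `n = 0` case of (3.42) for `G′` on `T_P`.  The abstract step (Cauchy–Schwarz + «lower bound ⟹ inverse bound») is g4's
`B9Thm311InverseL2BoundsZd.self_le_of_lower_bound` ∕ `sq_le_mul_of_symm_nonneg`, cited BY NAME; the class constant is `B9Thm31NearFlatCoerciveClassZdPer`'s; the flat
constant is `B9Thm31FlatPoincareCoerciveZdPer`'s; nothing re-declared.

WHAT IS PROVED (kernel, 0 sorry; theorems only — no `def`, no `instance`, no `notation`).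
* §1 `formPer_self_nonneg'` · `regularPrimePer_of_coercive` (a coercivity constant `c > 0` puts `U₀` in the scalar regime) · ★★ `formPer_GpPer_self_le_of_coercive`
  (`c⟨g,g⟩ ≤ ⟨g, Δ′_a(U₀)g⟩` for all `g` ⟹ `⟨G′f, G′f⟩_{T_P} ≤ c⁻²⟨f, f⟩_{T_P}`) · ★ `formPer_GpPer_le_of_coercive` (`⟨G′f, f⟩_{T_P} ≤ c⁻¹⟨f, f⟩_{T_P}`) ·
  `levFormPer_cPer_self_le_of_coercive` (the same for `(Q′G′²Q′*)⁻¹` from a coercivity constant of `Q′G′²Q′*`, `Q′G′²Q′*` bijective).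
* §2 ★★★ `formPer_GpPer_self_le_of_class` (ONE `L²_τ` BOUND FOR `G′(U₀)` AT EVERY BACKGROUND OF THE SMALL-FIELD CLASS OF THE TORUS: with
  `γ := a₀∕2 − (2C_uC_l)²(dθ′² + Ad²L²(256(d+1)(d+4)α₀ + θ′)²(m+1)) > 0`, `⟨G′(U₀)f, G′(U₀)f⟩_{T_P} ≤ γ⁻²⟨f, f⟩_{T_P}`), ★★ `formPer_GpPer_one_self_le` (the flat
  background: `⟨G′(1)f, G′(1)f⟩ ≤ a₀⁻²⟨f, f⟩` with `B9Thm31FlatPoincareCoerciveZdPer`'s `a₀`).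

HONEST SCOPE.  (i) `L²_τ` bounds only — the `n = 0` case of (3.42); NO derivative bounds (`n = 1, 2`) and NO exponential decay (Thm 3.1's main clause NOT proved);
scalar `G′` (and `(Q′G′²Q′*)⁻¹` from a displayed constant), not the vector `G` of the record.  (ii) Constants explicit; the class margin's positivity is a displayed
smallness condition.  (iii) Count-neutral; N05 ∕ N06 NOT discharged; K1⁹ `stmt-QuantumFields-27364` NOT closed; one finite `𝕋⁴` programme at fixed `ε`, Bałaban as
printed; R4 closes only the conditional finite-`𝕋⁴` rung `BalabanLadder.UV` — nothing continuum ∕ ℝ⁴ ∕ OS ∕ mass gap ∕ Clay.  Unit `pub-ymgap-dag-n06-w4` (g6), 2026-08-28.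
-/

noncomputable section

namespace Literature.MathematicalPhysics.QuantumFieldTheory.Balaban1983to89.B9Thm311InverseL2BoundsZdPer

open B7Prop1Explicit
open B7Prop2Explicit (unitaryUnits pdev C0 c2')
open T4TermwiseTorus (IsPeriodic box)
open B9Eq321LandauProjectionZdPer (perSub formPer formPer_apply formPer_isSymm formPer_apply_self_eq_zero)
open B9Eq324DeltaPrimeAZdPer (deltaPrimeAPer RegularPrimePer GpPer deltaPrimeAPer_GpPer bijective_of_form_pos)
open B9Eq325QGGQInvZdPer (levPer levFormPer levFormPer_isSymm levFormPer_self_nonneg qggqPer cPer qggqPer_cPer)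
open B9Eq342CombesThomasFormZd (fnorm)
open B9Thm311InverseL2BoundsZd (sq_le_mul_of_symm_nonneg self_le_of_lower_bound)
open B9Thm31NearFlatCoerciveClassZdPer (coercive_near_flat_per_of_class)
open B9Thm31FlatPoincareCoerciveZdPer (formPer_deltaPrimeAPer_one_coercive)

-- `Site` alone could resolve to the torus sites of `Setup.lean`; re-export the `ℤ^d` sites of `B7Prop1Explicit`.
export B7Prop1Explicit (Site)

variable {d : ℕ} {𝔸 : Type*} [CStarAlgebra 𝔸]
variable (τ : 𝔸 →ₗ[ℂ] ℂ) (hτp : ∀ a : 𝔸, a ≠ 0 → 0 < (τ (star a * a)).re)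
  (hτt : ∀ a b : 𝔸, τ (a * b) = τ (b * a)) (hτs : ∀ a : 𝔸, τ (star a) = starRingEnd ℂ (τ a))

/-! ## §1  From a coercivity constant to the bound of the inverse, on `L²(T_P, ·)` and `L²(𝔅_P, ·)` -/

section Coercive

variable {P L : ℕ} [NeZero P] {η : ℝ} {U₀ : Site d → Fin d → 𝔸ˣ} {m : ℕ} {a : ℕ → ℝ} {Λs : ℕ → Set (Site d)}

omit [NeZero P] in
include hτp in
/-- `⟨f, f⟩_{T_P} ≥ 0` (faithful `τ`). [cite: Balaban1985BackgroundPropagators, (3.21) p.394, p.390 («|X|² = tr X*X»)] -/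
theorem formPer_self_nonneg' (f : perSub (𝔸 := 𝔸) (d := d) P) : 0 ≤ formPer τ P f f := by
  rw [formPer_apply]
  refine Finset.sum_nonneg fun x _ => ?_
  by_cases h : (f : Site d → 𝔸) x = 0
  · rw [h, mul_zero, map_zero, Complex.zero_re]
  · exact (hτp _ h).le

include hτp in
/-- **A COERCIVITY CONSTANT PUTS THE BACKGROUND IN THE SCALAR REGIME**: `c⟨g, g⟩ ≤ ⟨g, Δ′_a(U₀)g⟩` for all `g` with `c > 0` ⟹ `Δ′_a(U₀)` is positive definite, hence
invertible on `L²(T_P)` (finite-dimensional fibre). [cite: Balaban1985BackgroundPropagators, Thm 3.11 p.416, (3.24) p.394 («Its inverse is denoted by G′»)] -/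
theorem regularPrimePer_of_coercive [FiniteDimensional ℝ 𝔸] {c : ℝ} (hc : 0 < c)
    (hco : ∀ g : perSub (𝔸 := 𝔸) (d := d) P, c * formPer τ P g g ≤ formPer τ P g (deltaPrimeAPer L U₀ η m a Λs P g)) :
    RegularPrimePer L U₀ η m a Λs P := by
  refine bijective_of_form_pos τ fun f hf => lt_of_lt_of_le ?_ (hco f)
  have hnn := formPer_self_nonneg' τ hτp f
  have hpos : 0 < formPer τ P f f := by
    rcases hnn.lt_or_eq with h | h
    · exact h
    · exact absurd (formPer_apply_self_eq_zero τ P hτp h.symm) hf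
  exact mul_pos hc hpos

include hτp hτs in
/-- ★★ **(3.42) AT `n = 0` FOR `G′(U₀)` ON THE TORUS, FROM A COERCIVITY CONSTANT**: `c⟨g, g⟩_{T_P} ≤ ⟨g, Δ′_a(U₀)g⟩_{T_P}` for all `g` with `c > 0` ⟹
`⟨G′(U₀)f, G′(U₀)f⟩_{T_P} ≤ c⁻²⟨f, f⟩_{T_P}` for every `f ∈ L²(T_P, ·)` (Hermitian faithful `τ`, finite-dimensional fibre; g4's `self_le_of_lower_bound`).
[cite: Balaban1985BackgroundPropagators, Thm 3.1 p.397, (3.42) p.397, (3.24) p.394; Balaban1984PropagatorsII, (2.22) p.226] -/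
theorem formPer_GpPer_self_le_of_coercive [FiniteDimensional ℝ 𝔸] {c : ℝ} (hc : 0 < c)
    (hco : ∀ g : perSub (𝔸 := 𝔸) (d := d) P, c * formPer τ P g g ≤ formPer τ P g (deltaPrimeAPer L U₀ η m a Λs P g)) (f : perSub (𝔸 := 𝔸) (d := d) P) :
    formPer τ P (GpPer L U₀ η m a Λs P f) (GpPer L U₀ η m a Λs P f) ≤ c⁻¹ ^ 2 * formPer τ P f f := by
  have hreg : RegularPrimePer L U₀ η m a Λs P := regularPrimePer_of_coercive τ hτp hc hco
  set g := GpPer L U₀ η m a Λs P f with hg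
  have h := hco g
  rw [hg, deltaPrimeAPer_GpPer hreg] at h
  exact self_le_of_lower_bound (formPer τ P) (fun v w => (formPer_isSymm τ P hτs).eq v w) (formPer_self_nonneg' τ hτp) hc h

include hτp hτs in
/-- ★ **`⟨G′(U₀)f, f⟩_{T_P} ≤ c⁻¹⟨f, f⟩_{T_P}`** (same hypotheses): `c⟨G′f, G′f⟩ ≤ ⟨G′f, Δ′_aG′f⟩ = ⟨G′f, f⟩` and Cauchy–Schwarz.
[cite: Balaban1985BackgroundPropagators, Thm 3.1 p.397, Thm 3.11 p.416; Balaban1984PropagatorsII, (2.22) p.226] -/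
theorem formPer_GpPer_le_of_coercive [FiniteDimensional ℝ 𝔸] {c : ℝ} (hc : 0 < c)
    (hco : ∀ g : perSub (𝔸 := 𝔸) (d := d) P, c * formPer τ P g g ≤ formPer τ P g (deltaPrimeAPer L U₀ η m a Λs P g)) (f : perSub (𝔸 := 𝔸) (d := d) P) :
    formPer τ P (GpPer L U₀ η m a Λs P f) f ≤ c⁻¹ * formPer τ P f f := by
  have hreg : RegularPrimePer L U₀ η m a Λs P := regularPrimePer_of_coercive τ hτp hc hco
  set g := GpPer L U₀ η m a Λs P f with hg
  have h := hco g
  rw [hg, deltaPrimeAPer_GpPer hreg] at h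
  -- `c⟨g,g⟩ ≤ ⟨g,f⟩` and `⟨g,f⟩² ≤ ⟨g,g⟩⟨f,f⟩`
  rw [← hg] at h
  have hCS := sq_le_mul_of_symm_nonneg (formPer τ P) (fun v w => (formPer_isSymm τ P hτs).eq v w) (formPer_self_nonneg' τ hτp) g f
  have hgg := formPer_self_nonneg' τ hτp g
  have hff := formPer_self_nonneg' τ hτp f
  by_cases hgf : formPer τ P g f ≤ 0
  · exact hgf.trans (mul_nonneg (inv_nonneg.2 hc.le) hff)
  · have hpos : 0 < formPer τ P g f := lt_of_not_ge hgf
    -- `c⟨g,f⟩² ≤ c⟨g,g⟩⟨f,f⟩ ≤ ⟨g,f⟩⟨f,f⟩`, divide by `⟨g,f⟩ > 0`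
    have h1 : c * (formPer τ P g f) ^ 2 ≤ formPer τ P g f * formPer τ P f f := by
      calc c * (formPer τ P g f) ^ 2 ≤ c * (formPer τ P g g * formPer τ P f f) := mul_le_mul_of_nonneg_left hCS hc.le
        _ = (c * formPer τ P g g) * formPer τ P f f := by ring
        _ ≤ formPer τ P g f * formPer τ P f f := mul_le_mul_of_nonneg_right h hff
    have h2 : c * formPer τ P g f ≤ formPer τ P f f := by
      have h3 : c * formPer τ P g f * formPer τ P g f ≤ formPer τ P f f * formPer τ P g f := by nlinarith [h1]
      exact le_of_mul_le_mul_right h3 hpos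
    rw [← div_eq_inv_mul, le_div_iff₀ hc]
    linarith [h2]

omit [NeZero P] in
include hτp hτs in
/-- **(3.42) AT `n = 0` FOR `(Q′G′²Q′*)⁻¹` ON THE TORUS, FROM A COERCIVITY CONSTANT**: `c⟨ψ, ψ⟩_{𝔅_P} ≤ ⟨ψ, Q′G′²Q′*ψ⟩_{𝔅_P}` for all `ψ` with `c > 0` and `Q′G′²Q′*`
bijective ⟹ `⟨(Q′G′²Q′*)⁻¹φ, (Q′G′²Q′*)⁻¹φ⟩_{𝔅_P} ≤ c⁻²⟨φ, φ⟩_{𝔅_P}`. [cite: Balaban1985BackgroundPropagators, (3.25) p.394, Thm 3.11 p.416; Balaban1984PropagatorsII, (2.22) p.226] -/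
theorem levFormPer_cPer_self_le_of_coercive (hb : Function.Bijective (qggqPer (𝔸 := 𝔸) (d := d) P L U₀ η m a Λs)) {c : ℝ} (hc : 0 < c)
    (hco : ∀ ψ : levPer (𝔸 := 𝔸) (d := d) P L m Λs, c * levFormPer τ P L m Λs ψ ψ ≤ levFormPer τ P L m Λs ψ (qggqPer P L U₀ η m a Λs ψ))
    (φ : levPer (𝔸 := 𝔸) (d := d) P L m Λs) :
    levFormPer τ P L m Λs (cPer P L U₀ η m a Λs φ) (cPer P L U₀ η m a Λs φ) ≤ c⁻¹ ^ 2 * levFormPer τ P L m Λs φ φ := by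
  set ψ := cPer P L U₀ η m a Λs φ with hψ
  have h := hco ψ
  rw [hψ, qggqPer_cPer hb] at h
  exact self_le_of_lower_bound (levFormPer τ P L m Λs) (fun v w => (levFormPer_isSymm τ P L m Λs hτs).eq v w) (levFormPer_self_nonneg τ P L m Λs hτp) hc h

end Coercive

/-! ## §2  One `L²_τ` bound for `G′(U₀)` over the small-field class of the torus; the flat background -/

section Class

variable [Nontrivial 𝔸] [FiniteDimensional ℝ 𝔸]
  {P L : ℕ} [NeZero P] [NeZero L] {η : ℝ} {U₀ : Site d → Fin d → 𝔸ˣ} {m k : ℕ} {a : ℕ → ℝ} {Λs : ℕ → Set (Site d)}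

include hτp hτt hτs in
/-- ★★★ **ONE `L²_τ` BOUND FOR `G′(U₀)` AT EVERY BACKGROUND OF THE SMALL-FIELD CLASS OF THE TORUS** ((3.42) at `n = 0`, «uniformly in U»): under the hypotheses of
`B9Thm31NearFlatCoerciveClassZdPer.coercive_near_flat_per_of_class` (unitary `P`-periodic `U₀`, `‖U₀(b) − 1‖ ≤ θ′η`, `pdev U₀ < α₀(L^k)^{−2}`, `m ≤ k`, weights, a flat
coercivity `a₀`) with `γ := a₀∕2 − (2C_uC_l)²(dθ′² + Ad²L²(256(d+1)(d+4)α₀ + θ′)²(m+1)) > 0`: `⟨G′(U₀)f, G′(U₀)f⟩_{T_P} ≤ γ⁻²·⟨f, f⟩_{T_P}` for every `f`.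
[cite: Balaban1985BackgroundPropagators, Thm 3.1 p.397, (3.42) p.397, Thm 3.11 p.416 («uniformly in U»), (3.35) p.396; Balaban1984PropagatorsII, (2.22) p.226; Balaban1985Averaging, Prop. 2 p.26] -/
theorem formPer_GpPer_self_le_of_class {Cu Cl : ℝ} (hCu : ∀ b : 𝔸, fnorm τ b ≤ Cu * ‖b‖) (hCl : ∀ b : 𝔸, ‖b‖ ≤ Cl * fnorm τ b) (hCu0 : 0 ≤ Cu) (hCl0 : 0 ≤ Cl)
    (hL : 2 ≤ L) (hη : 0 < η) (hUu : ∀ (x : Site d) (κ' : Fin d), U₀ x κ' ∈ unitaryUnits 𝔸) (hU : IsPeriodic P U₀)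
    {θ' : ℝ} (hθ' : 0 ≤ θ') (hR : ∀ (x : Site d) (μ : Fin d), ‖((U₀ x μ : 𝔸ˣ) : 𝔸) - 1‖ ≤ θ' * η)
    {α₀ : ℝ} (hα : 0 < α₀) (hα3 : C0 d * α₀ ≤ 1 / 3) (hα2 : 2 * α₀ ≤ c2' d L) (h52 : pdev U₀ < α₀ * (((L : ℝ) ^ k)⁻¹) ^ 2)
    (hm : m ≤ k) (hkη : ((L : ℝ) ^ k)⁻¹ ≤ η) (hηL : ∀ j ∈ Finset.range (m + 1), η * (L : ℝ) ^ j ≤ 1)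
    (ha : ∀ j, 0 ≤ a j) {A : ℝ} (haA : ∀ j ∈ Finset.range (m + 1), a j * η ^ 2 * ((L : ℝ) ^ j) ^ 2 ≤ A * ((L : ℝ) ^ j) ^ d) (hP : L ^ m ∣ P)
    {a₀ : ℝ} (hco : ∀ f : perSub (𝔸 := 𝔸) (d := d) P, a₀ * formPer τ P f f ≤ formPer τ P f (deltaPrimeAPer L (1 : Site d → Fin d → 𝔸ˣ) η m a Λs P f))
    (hmargin : (2 * Cu * Cl) ^ 2 * (d * θ' ^ 2 + A * d ^ 2 * (L : ℝ) ^ 2 * (256 * (d + 1) * (d + 4) * α₀ + θ') ^ 2 * (m + 1)) < a₀ / 2)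
    (f : perSub (𝔸 := 𝔸) (d := d) P) :
    formPer τ P (GpPer L U₀ η m a Λs P f) (GpPer L U₀ η m a Λs P f) ≤
      (a₀ / 2 - (2 * Cu * Cl) ^ 2 * (d * θ' ^ 2 + A * d ^ 2 * (L : ℝ) ^ 2 * (256 * (d + 1) * (d + 4) * α₀ + θ') ^ 2 * (m + 1)))⁻¹ ^ 2 *
        formPer τ P f f :=
  formPer_GpPer_self_le_of_coercive τ hτp hτs (by linarith)
    (coercive_near_flat_per_of_class τ hτp hτt hτs hCu hCl hCu0 hCl0 hL hη hUu hU hθ' hR hα hα3 hα2 h52 hm hkη hηL ha haA hP hco) f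

omit [Nontrivial 𝔸] in
include hτp hτt hτs in
/-- ★★ **THE FLAT BACKGROUND: `⟨G′(1)f, G′(1)f⟩_{T_P} ≤ a₀⁻²·⟨f, f⟩_{T_P}`** with `B9Thm31FlatPoincareCoerciveZdPer`'s constant (`0 < a₀ ≤ 8`, `a₀((Lᵐ))ᵈ ≤ a_mη²(Lᵐ)²`,
`ηLᵐ ≤ 1`, level `m` full on the cell, `Lᵐ ∣ P`). [cite: Balaban1985BackgroundPropagators, Thm 3.1 p.397, (3.42) p.397, Thm 3.11 p.416; Balaban1984PropagatorsII, (2.22) p.226] -/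
theorem formPer_GpPer_one_self_le (hη : 0 < η) (hηL : η * (L : ℝ) ^ m ≤ 1) (ha : ∀ j, 0 ≤ a j) {a₀ : ℝ} (ha₀0 : 0 < a₀) (ha₀8 : a₀ ≤ 8)
    (ha₀ : a₀ * ((L : ℝ) ^ m) ^ d ≤ a m * η ^ 2 * ((L : ℝ) ^ m) ^ 2) (hP : L ^ m ∣ P) (hΛm : ∀ y ∈ box (d := d) (P / L ^ m), y ∈ Λs m)
    (f : perSub (𝔸 := 𝔸) (d := d) P) :
    formPer τ P (GpPer L (1 : Site d → Fin d → 𝔸ˣ) η m a Λs P f) (GpPer L (1 : Site d → Fin d → 𝔸ˣ) η m a Λs P f) ≤ a₀⁻¹ ^ 2 * formPer τ P f f :=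
  formPer_GpPer_self_le_of_coercive τ hτp hτs ha₀0 (fun g => formPer_deltaPrimeAPer_one_coercive τ hτp hτs hη hηL ha ha₀8 ha₀ hP hΛm hτt g) f

end Class

end Literature.MathematicalPhysics.QuantumFieldTheory.Balaban1983to89.B9Thm311InverseL2BoundsZdPer
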